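import Summits.CriticalPhenomena.SAWScalingLimit.Theorems.SAWLoopFugacityFlowIsingBoundaryRatioRadialChainGlue
import Summits.CriticalPhenomena.SAWScalingLimit.Theorems.SAWLoopFugacityFlowIsingBoundaryRatioRadialLocalRSW
import HarnessLib

/-!
# The radial crossing lower bound: the lattice/probability core
(line `fk-anchor-transfer`, crux `IsingBoundaryRatio`, stmt-CriticalPhenomena-10650; helper file of the stub
`stub_halfAnnulusRadialCrossingBound`, RSW clause (iii))

Chart-free core of the bulk RSW chain. Data: a finite volume `Λ ⊆ ℤ²` with a graph `H` whose edges are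
nearest-neighbour pairs, sets `In`, `Ann`, `AnnFat ⊆ ↥Λ`, a "radius" `rad : ↥Λ → ℝ` with levels `ρ₁, ρ₂`, an
RSW unit `n ≥ 1`, and a chain of lattice squares `v i + [0, 4n]²`, `i ≤ L`, consecutive squares equal or
side-adjacent, all of whose sites are GOOD: they lie in `Λ` and in `AnnFat`, lattice neighbours among good sites
are `H`-adjacent, and the radius sorts them into `In` (`≤ ρ₁`), `Ann` (`(ρ₁, ρ₂)`), and the complement of
`In ∪ Ann` (`≥ ρ₂`); the first square has radius `≤ ρ₁`, the last `≥ ρ₂`. Conclusion (`radial_mainBound`):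
under the FREE critical FK–Ising measure of the local graph `⟨annEdgeFinset H AnnFat⟩` on `↥Λ`, the radial
crossing `AnnCross H In Ann` has probability `≥ c₀ ^ (3 (L + 1))`, `c₀ = min (min c₁ c₂) 1`, where `c₁`, `c₂`
bound from below the free crossing probabilities of translated `4m × m` / `m × 4m` lattice rectangles (the two
forms `fkIsing_rsw.shift`, `fkIsing_rsw.transpose_shift` of the tree's PROVED `fkIsing_rsw_holds`). Proof: the
`3 (L + 1)` increasing events "long crossing of the `4n × n` strip at the bottom of square `i`", "of the `n × 4n`
strip at its left", "of the `8n × 2n` / `2n × 8n` strip of the `i`-th domino" each have probability `≥ c₀`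
(`RadialChain.real_openCrossing_le_local`: free measures increase with the domain), hence occur together with
probability `≥ c₀ ^ (3(L+1))` (FKG, `RadialChain.rcMeasure_real_biInter_ge_pow`); on their intersection the
squares are crossed both ways and the dominoes the long way, so (`radial_squareChain`) an open path inside the
union of the squares joins the first square to the last, and its piece between the last visit to radius `≤ ρ₁`
and the next visit to radius `≥ ρ₂` is an `AnnCross` (`radial_annCross_of_openWalk`). [folklore]
-/

noncomputable section

open scoped Classical
open Set SimpleGraph MeasureTheory
open Literature.Probability.LatticeModels Literature.Probability.RandomPlanarGeometry
open Literature.Probability.Percolation (BondConfig openCrossing openGraph openConnIn isUpperSet_openCrossing)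

namespace Summit.CriticalPhenomena.SAWScalingLimit.Theorems.IsingBoundaryRatio

namespace RadialChain

variable {Λ : Finset (Site 2)}

/-! ### The crossing events of the chain, read on `ℤ²` -/

/-- The long (left-right) open crossing of the translated rectangle `u + [0, 4m] × [0, m]`, for the
configuration of `↥Λ` read on `ℤ²`. [folklore] -/
def lrEvent (Λ : Finset (Site 2)) (u : Site 2) (m : ℕ) : Set (BondConfig ↥Λ) :=
  {ω | Sym2.map (Subtype.val : ↥Λ → Site 2) '' ω ∈ openCrossing (↑(rectAt u (4 * m) m) : Set (Site 2))
    {z | z ∈ rectAt u (4 * m) m ∧ z 0 = u 0} {z | z ∈ rectAt u (4 * m) m ∧ z 0 = u 0 + 4 * m}}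

/-- The long (bottom-top) open crossing of the translated rectangle `u + [0, m] × [0, 4m]`, read on `ℤ²`.
[folklore] -/
def tbEvent (Λ : Finset (Site 2)) (u : Site 2) (m : ℕ) : Set (BondConfig ↥Λ) :=
  {ω | Sym2.map (Subtype.val : ↥Λ → Site 2) '' ω ∈ openCrossing (↑(rectAt u m (4 * m)) : Set (Site 2))
    {z | z ∈ rectAt u m (4 * m) ∧ z 1 = u 1} {z | z ∈ rectAt u m (4 * m) ∧ z 1 = u 1 + 4 * m}}

/-- The domino event of index `i` of the chain `v` with unit `n`: the long crossing of the `8n × 2n` strip of the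
horizontal domino on the squares `i`, `i + 1` if they differ horizontally, of the `2n × 8n` strip of the vertical
domino if they differ vertically, and the sure event if they coincide. [folklore] -/
def dominoEvent (Λ : Finset (Site 2)) (v : ℕ → Site 2) (n L i : ℕ) : Set (BondConfig ↥Λ) :=
  if i < L then
    (if v (i + 1) 0 ≠ v i 0 then lrEvent Λ (v i ⊓ v (i + 1)) (2 * n)
      else if v (i + 1) 1 ≠ v i 1 then tbEvent Λ (v i ⊓ v (i + 1)) (2 * n) else Set.univ)
  else Set.univ

/-- The `3 (L + 1)` events of the chain, indexed by `ℕ × Fin 3` (the domino event of index `L` is the sure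
event). [folklore] -/
def chainEvent (Λ : Finset (Site 2)) (v : ℕ → Site 2) (n L : ℕ) (p : ℕ × Fin 3) : Set (BondConfig ↥Λ) :=
  ![lrEvent Λ (v p.1) n, tbEvent Λ (v p.1) n, dominoEvent Λ v n L p.1] p.2

/-- The events are increasing. [folklore] -/
theorem isUpperSet_lrEvent (u : Site 2) (m : ℕ) : IsUpperSet (lrEvent Λ u m) :=
  fun _ _ h hω => isUpperSet_openCrossing _ _ _ (Set.image_mono h) hω

/-- The events are increasing. [folklore] -/
theorem isUpperSet_tbEvent (u : Site 2) (m : ℕ) : IsUpperSet (tbEvent Λ u m) :=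
  fun _ _ h hω => isUpperSet_openCrossing _ _ _ (Set.image_mono h) hω

/-- The events are increasing. [folklore] -/
theorem isUpperSet_dominoEvent (v : ℕ → Site 2) (n L i : ℕ) : IsUpperSet (dominoEvent Λ v n L i) := by
  unfold dominoEvent; split_ifs
  exacts [isUpperSet_lrEvent _ _, isUpperSet_tbEvent _ _, isUpperSet_univ, isUpperSet_univ]

/-- The events are increasing. [folklore] -/
theorem isUpperSet_chainEvent (v : ℕ → Site 2) (n L : ℕ) (p : ℕ × Fin 3) : IsUpperSet (chainEvent Λ v n L p) := by
  obtain ⟨i, k⟩ := p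
  fin_cases k
  · exact isUpperSet_lrEvent _ _
  · exact isUpperSet_tbEvent _ _
  · exact isUpperSet_dominoEvent _ _ _ _

/-! ### Their probabilities under the free measure of a local graph -/

/-- **The strip `u + [0, 4m] × [0, m]` is crossed the long way with probability `≥ c₁`** under the free critical
FK–Ising measure of any graph `G₀` on `↥Λ` containing its nearest-neighbour pairs as edges (`c₁` the constant of
`fkIsing_rsw.shift`). [cite: DuminilCopinSmirnov2012Clay, Thm. 3.16] -/
theorem le_real_lrEvent (G₀ : SimpleGraph ↥Λ) [DecidableRel G₀.Adj] {c₁ : ℝ}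
    (hRSW₁ : ∀ m : ℕ, 1 ≤ m → ∀ (v : Site 2) (S' : Finset (Site 2)),
      (∀ x, x ∈ S' ↔ x - v ∈ Literature.Probability.Percolation.rectangle (4 * m) m) →
      c₁ ≤ (fkIsingFiniteMeasure S' ∅).real (openCrossing Set.univ {x | x.1 0 = v 0} {x | x.1 0 = v 0 + 4 * m}))
    (u : Site 2) {m : ℕ} (hm : 1 ≤ m) (hS : ∀ x ∈ rectAt u (4 * m) m, x ∈ Λ)
    (hadj : ∀ (x y : Site 2) (hx : x ∈ rectAt u (4 * m) m) (hy : y ∈ rectAt u (4 * m) m),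
      (zdGraph 2).Adj x y → G₀.Adj ⟨x, hS x hx⟩ ⟨y, hS y hy⟩) :
    c₁ ≤ (rcMeasure G₀ criticalFKIsingParam 2 ∅).real (lrEvent Λ u m) :=
  (hRSW₁ m hm u _ fun _ => mem_rectAt_iff_sub_mem).trans
    (real_openCrossing_le_local G₀ _ hS hadj (fun z => z 0 = u 0) fun z => z 0 = u 0 + 4 * m)

/-- **The strip `u + [0, m] × [0, 4m]` is crossed the long way with probability `≥ c₂`** (`c₂` the constant of
`fkIsing_rsw.transpose_shift`). [cite: DuminilCopinSmirnov2012Clay, Thm. 3.16] -/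
theorem le_real_tbEvent (G₀ : SimpleGraph ↥Λ) [DecidableRel G₀.Adj] {c₂ : ℝ}
    (hRSW₂ : ∀ m : ℕ, 1 ≤ m → ∀ (v : Site 2) (S' : Finset (Site 2)),
      (∀ x, x ∈ S' ↔ (![x 1 - v 1, x 0 - v 0] : Site 2) ∈ Literature.Probability.Percolation.rectangle (4 * m) m) →
      c₂ ≤ (fkIsingFiniteMeasure S' ∅).real (openCrossing Set.univ {x | x.1 1 = v 1} {x | x.1 1 = v 1 + 4 * m}))
    (u : Site 2) {m : ℕ} (hm : 1 ≤ m) (hS : ∀ x ∈ rectAt u m (4 * m), x ∈ Λ)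
    (hadj : ∀ (x y : Site 2) (hx : x ∈ rectAt u m (4 * m)) (hy : y ∈ rectAt u m (4 * m)),
      (zdGraph 2).Adj x y → G₀.Adj ⟨x, hS x hx⟩ ⟨y, hS y hy⟩) :
    c₂ ≤ (rcMeasure G₀ criticalFKIsingParam 2 ∅).real (tbEvent Λ u m) :=
  (hRSW₂ m hm u _ fun _ => mem_rectAt_iff_transpose_mem).trans
    (real_openCrossing_le_local G₀ _ hS hadj (fun z => z 1 = u 1) fun z => z 1 = u 1 + 4 * m)

/-! ### On the events, the squares and dominoes are crossed -/

/-- On `lrEvent`, every box `u + [0, 4m] × [0, b]`, `b ≥ m`, has an open left-right crossing. [folklore] -/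
theorem crossLR_of_mem_lrEvent {u : Site 2} {m b : ℕ} (hmb : m ≤ b) {ω : BondConfig ↥Λ} (h : ω ∈ lrEvent Λ u m) :
    ∃ x z, Sym2.map (Subtype.val : ↥Λ → Site 2) '' ω ∈ crossLR u (4 * m) b x z := by
  obtain ⟨x, ⟨-, hx0⟩, z, ⟨-, hz0⟩, hconn⟩ := h
  refine ⟨x, z, hx0, by rw [hz0]; push_cast; ring, Literature.Probability.Percolation.openConnIn_mono ?_ _ _ hconn⟩
  intro w hw
  rw [Finset.mem_coe, mem_rectAt_iff] at hw
  rw [mem_boxSet]; push_cast; omega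

/-- On `tbEvent`, every box `u + [0, a] × [0, 4m]`, `a ≥ m`, has an open top-bottom crossing. [folklore] -/
theorem crossTB_of_mem_tbEvent {u : Site 2} {m a : ℕ} (hma : m ≤ a) {ω : BondConfig ↥Λ} (h : ω ∈ tbEvent Λ u m) :
    ∃ x z, Sym2.map (Subtype.val : ↥Λ → Site 2) '' ω ∈ crossTB u a (4 * m) x z := by
  obtain ⟨x, ⟨-, hx1⟩, z, ⟨-, hz1⟩, hconn⟩ := h
  refine ⟨x, z, hx1, by rw [hz1]; push_cast; ring, Literature.Probability.Percolation.openConnIn_mono ?_ _ _ hconn⟩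
  intro w hw
  rw [Finset.mem_coe, mem_rectAt_iff] at hw
  rw [mem_boxSet]; push_cast; omega

/-! ### Adjacent squares of the chain -/

/-- If `v k' = v k + (4n, 0)` then `v k ⊓ v k' = v k = v k' ⊓ v k`. [folklore] -/
theorem inf_eq_of_step {v : ℕ → Site 2} {k k' : ℕ} {a b : ℤ} (ha : 0 ≤ a) (hb : 0 ≤ b)
    (h : v k' = v k + ![a, b]) : v k ⊓ v k' = v k ∧ v k' ⊓ v k = v k := by
  have hle : v k ≤ v k' := by
    rw [h]; intro i; fin_cases i <;> simp [ha, hb]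
  exact ⟨inf_eq_left.2 hle, inf_eq_right.2 hle⟩

/-- Coordinates of a step. [folklore] -/
theorem apply_eq_of_step {x y : Site 2} {a b : ℤ} (h : x = y + ![a, b]) : x 0 = y 0 + a ∧ x 1 = y 1 + b := by
  rw [h]; simp

/-- The `8n × 2n` strip of a horizontal domino lies in the union of its two squares. [folklore] -/
theorem rectAt_domino_subset {v : ℕ → Site 2} {n k k' : ℕ} (h : v k' = v k + ![((4 * n : ℕ) : ℤ), 0])
    {x : Site 2} (hx : x ∈ rectAt (v k) (4 * (2 * n)) (2 * n)) :
    x ∈ boxSet (v k) (4 * n) (4 * n) ∨ x ∈ boxSet (v k') (4 * n) (4 * n) := by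
  rw [mem_rectAt_iff] at hx
  rw [mem_boxSet, mem_boxSet, h]
  simp only [Pi.add_apply, Matrix.cons_val_zero, Matrix.cons_val_one, Matrix.cons_val_fin_one]
  push_cast at hx ⊢; omega

/-- The `2n × 8n` strip of a vertical domino lies in the union of its two squares. [folklore] -/
theorem rectAt_domino_subset' {v : ℕ → Site 2} {n k k' : ℕ} (h : v k' = v k + ![(0 : ℤ), ((4 * n : ℕ) : ℤ)])
    {x : Site 2} (hx : x ∈ rectAt (v k) (2 * n) (4 * (2 * n))) :
    x ∈ boxSet (v k) (4 * n) (4 * n) ∨ x ∈ boxSet (v k') (4 * n) (4 * n) := by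
  rw [mem_rectAt_iff] at hx
  rw [mem_boxSet, mem_boxSet, h]
  simp only [Pi.add_apply, Matrix.cons_val_zero, Matrix.cons_val_one, Matrix.cons_val_fin_one]
  push_cast at hx ⊢; omega

/-- A `4n × n` or `n × 4n` strip at the corner of a square lies in the square. [folklore] -/
theorem rectAt_subset_boxSet {u x : Site 2} {a b n : ℕ} (ha : a ≤ 4 * n) (hb : b ≤ 4 * n)
    (hx : x ∈ rectAt u a b) : x ∈ boxSet u (4 * n) (4 * n) := by
  rw [mem_rectAt_iff] at hx; rw [mem_boxSet]; push_cast; omega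

end RadialChain

/-! ### The main bound -/

open RadialChain in
/-- **The radial crossing lower bound, lattice/probability core** (registered sub-goal of
stmt-CriticalPhenomena-10650, clause (iii) helper; see the module docstring for the statement and the proof).
[folklore] -/
theorem radial_mainBound : ∀ {Λ : Finset (Site 2)} (H : SimpleGraph ↥Λ) (In Ann AnnFat : Set ↥Λ) (rad : ↥Λ → ℝ) (ρ₁ ρ₂ c₁ c₂ : ℝ) (n L : ℕ) (v : ℕ → Site 2), (∀ a b : ↥Λ, H.Adj a b → (zdGraph 2).Adj a.1 b.1) → 0 < c₁ → 0 < c₂ → (∀ m : ℕ, 1 ≤ m → ∀ (w : Site 2) (S' : Finset (Site 2)), (∀ x, x ∈ S' ↔ x - w ∈ Literature.Probability.Percolation.rectangle (4 * m) m) → c₁ ≤ (fkIsingFiniteMeasure S' ∅).real (openCrossing Set.univ {x | x.1 0 = w 0} {x | x.1 0 = w 0 + 4 * m})) → (∀ m : ℕ, 1 ≤ m → ∀ (w : Site 2) (S' : Finset (Site 2)), (∀ x, x ∈ S' ↔ (![x 1 - w 1, x 0 - w 0] : Site 2) ∈ Literature.Probability.Percolation.rectangle (4 * m) m) → c₂ ≤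 (fkIsingFiniteMeasure S' ∅).real (openCrossing Set.univ {x | x.1 1 = w 1} {x | x.1 1 = w 1 + 4 * m})) → 1 ≤ n → (∀ i < L, v (i + 1) = v i ∨ v (i + 1) = v i + ![((4 * n : ℕ) : ℤ), 0] ∨ v i = v (i + 1) + ![((4 * n : ℕ) : ℤ), 0] ∨ v (i + 1) = v i + ![(0 : ℤ), ((4 * n : ℕ) : ℤ)] ∨ v i = v (i + 1) + ![(0 : ℤ), ((4 * n : ℕ) : ℤ)]) → (∀ i ≤ L, ∀ x ∈ RadialChain.boxSet (v i) (4 * n) (4 * n), ∃ hx : x ∈ Λ, (⟨x, hx⟩ : ↥Λ) ∈ AnnFat ∧ (∀ i' ≤ L, ∀ y ∈ RadialChain.boxSet (v i') (4 * n) (4 * n), ∀ hy : y ∈ Λ, (zdGraph 2).Adj x y → H.Adj ⟨x, hx⟩ ⟨y, hy⟩) ∧ (rad ⟨x, hx⟩ ≤ ρ₁ → (⟨x, hx⟩ : ↥Λ) ∈ In) ∧ (ρ₁ < rad ⟨x, hx⟩ → rad ⟨x, hx⟩ < ρ₂ → (⟨x, hx⟩ : ↥Λ) ∈ Ann) ∧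 (ρ₂ ≤ rad ⟨x, hx⟩ → (⟨x, hx⟩ : ↥Λ) ∉ In ∪ Ann)) → (∀ x ∈ RadialChain.boxSet (v 0) (4 * n) (4 * n), ∀ hx : x ∈ Λ, rad ⟨x, hx⟩ ≤ ρ₁) → (∀ x ∈ RadialChain.boxSet (v L) (4 * n) (4 * n), ∀ hx : x ∈ Λ, ρ₂ ≤ rad ⟨x, hx⟩) → min (min c₁ c₂) 1 ^ (3 * (L + 1)) ≤ (rcMeasure (fromEdgeSet (↑(annEdgeFinset H AnnFat) : Set (Sym2 ↥Λ))) criticalFKIsingParam 2 ∅).real {ω | AnnCross H In Ann ω} := by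
  intro Λ H In Ann AnnFat rad ρ₁ ρ₂ c₁ c₂ n L v hH hc₁ hc₂ hRSW₁ hRSW₂ hn hstep hgood hfirst hlast
  have hp := criticalFKIsingParam_mem_Icc
  set Gann : SimpleGraph ↥Λ := fromEdgeSet (↑(annEdgeFinset H AnnFat) : Set (Sym2 ↥Λ)) with hGann
  set c₀ : ℝ := min (min c₁ c₂) 1 with hc₀
  have hc₀0 : 0 ≤ c₀ := by positivity
  have hc₀1 : c₀ ≤ c₁ := (min_le_left _ _).trans (min_le_left _ _)
  have hc₀2 : c₀ ≤ c₂ := (min_le_left _ _).trans (min_le_right _ _)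
  have hc₀3 : c₀ ≤ 1 := min_le_right _ _
  haveI : IsProbabilityMeasure (rcMeasure Gann criticalFKIsingParam 2 ∅) := isProbabilityMeasure_rcMeasure _ hp two_pos _
  have hs1 : 1 ≤ 4 * n := by omega
  -- good sites: membership in `Λ`, and `Gann`-adjacency of lattice neighbours among good sites
  have hΛ : ∀ i ≤ L, ∀ x ∈ boxSet (v i) (4 * n) (4 * n), x ∈ Λ := fun i hi x hx => (hgood i hi x hx).1
  have hGadj : ∀ (i : ℕ) (hi : i ≤ L) (i' : ℕ) (hi' : i' ≤ L) (x y : Site 2) (hx : x ∈ boxSet (v i) (4 * n) (4 * n))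
      (hy : y ∈ boxSet (v i') (4 * n) (4 * n)), (zdGraph 2).Adj x y →
      Gann.Adj ⟨x, hΛ i hi x hx⟩ ⟨y, hΛ i' hi' y hy⟩ := by
    intro i hi i' hi' x y hx hy hxy
    obtain ⟨hxΛ, hfat, hadj, -⟩ := hgood i hi x hx
    have hHadj := hadj i' hi' y hy (hΛ i' hi' y hy) hxy
    rw [hGann, fromEdgeSet_adj, Finset.mem_coe, mem_annEdgeFinset]
    exact ⟨⟨(mem_edgeSet H).2 hHadj, _, hfat, Sym2.mem_mk_left _ _⟩, hHadj.ne⟩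
  -- the events and their probabilities
  set sF : Finset (ℕ × Fin 3) := Finset.range (L + 1) ×ˢ Finset.univ with hsF
  have hcard : sF.card = 3 * (L + 1) := by
    rw [hsF, Finset.card_product, Finset.card_range, Finset.card_univ, Fintype.card_fin]; ring
  have hprob : ∀ p ∈ sF, c₀ ≤ (rcMeasure Gann criticalFKIsingParam 2 ∅).real (chainEvent Λ v n L p) := by
    rintro ⟨i, k⟩ hp'
    have hi : i ≤ L := by
      rw [hsF, Finset.mem_product, Finset.mem_range] at hp'; exact Nat.lt_succ_iff.1 hp'.1
    fin_cases k
    · -- long crossing of the `4n × n` strip at the bottom of square `i`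
      show c₀ ≤ (rcMeasure Gann criticalFKIsingParam 2 ∅).real (lrEvent Λ (v i) n)
      refine hc₀1.trans (le_real_lrEvent Gann hRSW₁ (v i) hn
        (fun x hx => hΛ i hi x (rectAt_subset_boxSet le_rfl (by omega) hx)) fun x y hx hy hxy => ?_)
      exact hGadj i hi i hi x y (rectAt_subset_boxSet le_rfl (by omega) hx) (rectAt_subset_boxSet le_rfl (by omega) hy) hxy
    · -- long crossing of the `n × 4n` strip at the left of square `i`
      show c₀ ≤ (rcMeasure Gann criticalFKIsingParam 2 ∅).real (tbEvent Λ (v i) n)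
      refine hc₀2.trans (le_real_tbEvent Gann hRSW₂ (v i) hn
        (fun x hx => hΛ i hi x (rectAt_subset_boxSet (by omega) le_rfl hx)) fun x y hx hy hxy => ?_)
      exact hGadj i hi i hi x y (rectAt_subset_boxSet (by omega) le_rfl hx) (rectAt_subset_boxSet (by omega) le_rfl hy) hxy
    · -- the domino event
      show c₀ ≤ (rcMeasure Gann criticalFKIsingParam 2 ∅).real (dominoEvent Λ v n L i)
      unfold dominoEvent
      by_cases hiL : i < L
      · rw [if_pos hiL]
        have h2n : 1 ≤ 2 * n := by omega
        have hS₀ : ∀ {k k' : ℕ}, k ≤ L → k' ≤ L → v k' = v k + ![((4 * n : ℕ) : ℤ), 0] →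
            ∀ x ∈ rectAt (v k) (4 * (2 * n)) (2 * n), x ∈ Λ := by
          intro k k' hk hk' h x hx
          rcases rectAt_domino_subset h hx with h' | h'
          exacts [hΛ k hk x h', hΛ k' hk' x h']
        have hA₀ : ∀ {k k' : ℕ} (hk : k ≤ L) (hk' : k' ≤ L) (h : v k' = v k + ![((4 * n : ℕ) : ℤ), 0]),
            ∀ (x y : Site 2) (hx : x ∈ rectAt (v k) (4 * (2 * n)) (2 * n)) (hy : y ∈ rectAt (v k) (4 * (2 * n)) (2 * n)),
            (zdGraph 2).Adj x y → Gann.Adj ⟨x, hS₀ hk hk' h x hx⟩ ⟨y, hS₀ hk hk' h y hy⟩ := by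
          intro k k' hk hk' h x y hx hy hxy
          rcases rectAt_domino_subset h hx with hx' | hx' <;> rcases rectAt_domino_subset h hy with hy' | hy'
          exacts [hGadj k hk k hk x y hx' hy' hxy, hGadj k hk k' hk' x y hx' hy' hxy,
            hGadj k' hk' k hk x y hx' hy' hxy, hGadj k' hk' k' hk' x y hx' hy' hxy]
        have hS₁ : ∀ {k k' : ℕ}, k ≤ L → k' ≤ L → v k' = v k + ![(0 : ℤ), ((4 * n : ℕ) : ℤ)] →
            ∀ x ∈ rectAt (v k) (2 * n) (4 * (2 * n)), x ∈ Λ := by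
          intro k k' hk hk' h x hx
          rcases rectAt_domino_subset' h hx with h' | h'
          exacts [hΛ k hk x h', hΛ k' hk' x h']
        have hA₁ : ∀ {k k' : ℕ} (hk : k ≤ L) (hk' : k' ≤ L) (h : v k' = v k + ![(0 : ℤ), ((4 * n : ℕ) : ℤ)]),
            ∀ (x y : Site 2) (hx : x ∈ rectAt (v k) (2 * n) (4 * (2 * n))) (hy : y ∈ rectAt (v k) (2 * n) (4 * (2 * n))),
            (zdGraph 2).Adj x y → Gann.Adj ⟨x, hS₁ hk hk' h x hx⟩ ⟨y, hS₁ hk hk' h y hy⟩ := by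
          intro k k' hk hk' h x y hx hy hxy
          rcases rectAt_domino_subset' h hx with hx' | hx' <;> rcases rectAt_domino_subset' h hy with hy' | hy'
          exacts [hGadj k hk k hk x y hx' hy' hxy, hGadj k hk k' hk' x y hx' hy' hxy,
            hGadj k' hk' k hk x y hx' hy' hxy, hGadj k' hk' k' hk' x y hx' hy' hxy]
        have h4n : (0 : ℤ) ≤ ((4 * n : ℕ) : ℤ) := by positivity
        split_ifs with h0 h1
        · -- horizontal domino: squares `i`, `i + 1` differ by `(± 4n, 0)`
          rcases hstep i hiL with h | h | h | h | h
          · exact absurd (by rw [h]) h0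
          · rw [(inf_eq_of_step h4n le_rfl h).1]
            exact hc₀1.trans (le_real_lrEvent Gann hRSW₁ (v i) h2n (hS₀ hiL.le hiL h) (hA₀ hiL.le hiL h))
          · rw [(inf_eq_of_step h4n le_rfl h).2]
            exact hc₀1.trans (le_real_lrEvent Gann hRSW₁ (v (i + 1)) h2n (hS₀ hiL hiL.le h) (hA₀ hiL hiL.le h))
          · exact absurd (by have := (apply_eq_of_step h).1; omega) h0
          · exact absurd (by have := (apply_eq_of_step h).1; omega) h0
        · -- vertical domino
          rcases hstep i hiL with h | h | h | h | h
          · exact absurd (by rw [h]) h1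
          · exact absurd (by have := (apply_eq_of_step h).2; omega) h1
          · exact absurd (by have := (apply_eq_of_step h).2; omega) h1
          · rw [(inf_eq_of_step le_rfl h4n h).1]
            exact hc₀2.trans (le_real_tbEvent Gann hRSW₂ (v i) h2n (hS₁ hiL.le hiL h) (hA₁ hiL.le hiL h))
          · rw [(inf_eq_of_step le_rfl h4n h).2]
            exact hc₀2.trans (le_real_tbEvent Gann hRSW₂ (v (i + 1)) h2n (hS₁ hiL hiL.le h) (hA₁ hiL hiL.le h))
        · rw [probReal_univ]; exact hc₀3
      · rw [if_neg hiL, probReal_univ]; exact hc₀3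
  -- FKG
  have hfkg := rcMeasure_real_biInter_ge_pow Gann hp one_le_two ∅ sF (chainEvent Λ v n L)
    (fun p _ => isUpperSet_chainEvent v n L p) hc₀0 hprob
  rw [hcard] at hfkg
  refine hfkg.trans (rcMeasure_real_mono_on_edgeSets Gann hp two_pos ∅ fun ω hωE hω => ?_)
  -- on the intersection (and `ω ⊆ E(Gann)`): the radial crossing
  have hmem : ∀ i ≤ L, ∀ k : Fin 3, ω ∈ chainEvent Λ v n L (i, k) := fun i hi k =>
    Set.mem_iInter₂.1 hω (i, k) (by
      rw [hsF, Finset.mem_product, Finset.mem_range]; exact ⟨Nat.lt_succ_of_le hi, Finset.mem_univ _⟩)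
  have hωH : ∀ e ∈ ω, e ∈ H.edgeSet := by
    intro e he
    have := hωE he
    rw [hGann, edgeSet_fromEdgeSet] at this
    exact (mem_annEdgeFinset.1 (Finset.mem_coe.1 this.1)).1
  set ω' : BondConfig (Site 2) := Sym2.map (Subtype.val : ↥Λ → Site 2) '' ω with hω'
  have hω'E : ω' ⊆ (zdGraph 2).edgeSet := by
    rintro _ ⟨e, he, rfl⟩
    have heH := hωH e he
    induction e using Sym2.ind with
    | h a b => rw [Sym2.map_mk, mem_edgeSet]; exact hH a b ((mem_edgeSet H).1 heH)
  -- the hypotheses of the chain lemma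
  have hLR : ∀ i ≤ L, ∃ x z, ω' ∈ crossLR (v i) (4 * n) (4 * n) x z := fun i hi =>
    crossLR_of_mem_lrEvent (m := n) (b := 4 * n) (by omega) (hmem i hi 0)
  have hTB : ∀ i ≤ L, ∃ x z, ω' ∈ crossTB (v i) (4 * n) (4 * n) x z := fun i hi =>
    crossTB_of_mem_tbEvent (m := n) (a := 4 * n) (by omega) (hmem i hi 1)
  have h4n0 : ((4 * n : ℕ) : ℤ) ≠ 0 := by positivity
  have h4n : (0 : ℤ) ≤ ((4 * n : ℕ) : ℤ) := by positivity
  have hHd : ∀ i < L, ∀ k k', (k = i ∧ k' = i + 1 ∨ k = i + 1 ∧ k' = i) →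
      v k' = v k + ![((4 * n : ℕ) : ℤ), 0] → ∃ x z, ω' ∈ crossLR (v k) (2 * (4 * n)) (4 * n) x z := by
    intro i hiL k k' hkk' h
    have hev : ω ∈ dominoEvent Λ v n L i := hmem i hiL.le 2
    have h0 : v (i + 1) 0 ≠ v i 0 := by
      have := (apply_eq_of_step h).1
      rcases hkk' with ⟨rfl, rfl⟩ | ⟨rfl, rfl⟩ <;> omega
    have hinf : v i ⊓ v (i + 1) = v k := by
      rcases hkk' with ⟨rfl, rfl⟩ | ⟨rfl, rfl⟩
      exacts [(inf_eq_of_step h4n le_rfl h).1, (inf_eq_of_step h4n le_rfl h).2]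
    unfold dominoEvent at hev
    rw [if_pos hiL, if_pos h0, hinf] at hev
    obtain ⟨x, z, hxz⟩ := crossLR_of_mem_lrEvent (m := 2 * n) (b := 4 * n) (by omega) hev
    exact ⟨x, z, by rwa [show 4 * (2 * n) = 2 * (4 * n) by ring] at hxz⟩
  have hVd : ∀ i < L, ∀ k k', (k = i ∧ k' = i + 1 ∨ k = i + 1 ∧ k' = i) →
      v k' = v k + ![(0 : ℤ), ((4 * n : ℕ) : ℤ)] → ∃ x z, ω' ∈ crossTB (v k) (4 * n) (2 * (4 * n)) x z := by
    intro i hiL k k' hkk' h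
    have hev : ω ∈ dominoEvent Λ v n L i := hmem i hiL.le 2
    have h0 : ¬ (v (i + 1) 0 ≠ v i 0) := by
      have := (apply_eq_of_step h).1
      rcases hkk' with ⟨rfl, rfl⟩ | ⟨rfl, rfl⟩ <;> omega
    have h1 : v (i + 1) 1 ≠ v i 1 := by
      have := (apply_eq_of_step h).2
      rcases hkk' with ⟨rfl, rfl⟩ | ⟨rfl, rfl⟩ <;> omega
    have hinf : v i ⊓ v (i + 1) = v k := by
      rcases hkk' with ⟨rfl, rfl⟩ | ⟨rfl, rfl⟩
      exacts [(inf_eq_of_step le_rfl h4n h).1, (inf_eq_of_step le_rfl h4n h).2]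
    unfold dominoEvent at hev
    rw [if_pos hiL, if_neg h0, if_pos h1, hinf] at hev
    obtain ⟨x, z, hxz⟩ := crossTB_of_mem_tbEvent (m := 2 * n) (a := 4 * n) (by omega) hev
    exact ⟨x, z, by rwa [show 4 * (2 * n) = 2 * (4 * n) by ring] at hxz⟩
  obtain ⟨x₀, hx₀, y₀, hy₀, hconn⟩ := exists_openConnIn_of_squareChain hω'E (4 * n) v L hstep hLR hTB hHd hVd
  -- pull back to `↥Λ`
  set vP : ↥Λ ↪ Site 2 := Function.Embedding.subtype _ with hvP
  have himg : ∀ S : Set (Site 2), (∀ x ∈ S, x ∈ Λ) → S = vP '' {a : ↥Λ | a.1 ∈ S} := by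
    intro S hSΛ
    ext x
    simp only [Set.mem_image, Set.mem_setOf_eq]
    constructor
    · intro hx; exact ⟨⟨x, hSΛ x hx⟩, hx, rfl⟩
    · rintro ⟨a, ha, rfl⟩; exact ha
  have hRΛ : ∀ x ∈ chainRegion v (4 * n) L, x ∈ Λ := fun x ⟨k, hk, hx⟩ => hΛ k hk x hx
  have hcross : ω ∈ openCrossing {a : ↥Λ | a.1 ∈ chainRegion v (4 * n) L}
      {a : ↥Λ | a.1 ∈ boxSet (v 0) (4 * n) (4 * n)} {a : ↥Λ | a.1 ∈ boxSet (v L) (4 * n) (4 * n)} :=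
    (map_image_mem_openCrossing_iff' vP ω _ _ _ _ _ _ (himg _ hRΛ) (himg _ (hΛ 0 (Nat.zero_le _)))
      (himg _ (hΛ L le_rfl))).1 ⟨x₀, hx₀, y₀, hy₀, hconn⟩
  obtain ⟨a, b, W, ha, hb, hWs, hWe⟩ := exists_openWalk_of_openCrossing H hωH hcross
  refine annCross_of_openWalk H In Ann ω rad W hWe (hfirst a.1 ha a.2) (hlast b.1 hb b.2)
    (fun z hz hr => ?_) (fun z hz hr1 hr2 => ?_) (fun z hz hr => ?_)
  · obtain ⟨k, hk, hzk⟩ := hWs z hz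
    obtain ⟨hzΛ, -, -, hIn, -, -⟩ := hgood k hk z.1 hzk
    exact hIn hr
  · obtain ⟨k, hk, hzk⟩ := hWs z hz
    obtain ⟨hzΛ, -, -, -, hAnn, -⟩ := hgood k hk z.1 hzk
    exact hAnn hr1 hr2
  · obtain ⟨k, hk, hzk⟩ := hWs z hz
    obtain ⟨hzΛ, -, -, -, -, hout⟩ := hgood k hk z.1 hzk
    exact hout hr

end Summit.CriticalPhenomena.SAWScalingLimit.Theorems.IsingBoundaryRatio

end
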